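import Summits.ResolutionOfSingularities.ResolutionOfSingularities.Theorems.HilbertSamuelEliminationSigmaMaxModificationsCorridor3WLadderIsoKernelCPSlice
import Literature.AlgebraicGeometry.Resolution.HilbertSamuelRegular
import Literature.AlgebraicGeometry.Resolution.HilbertSamuelGenericConstancyExcellent
import Literature.AlgebraicGeometry.Resolution.ExcellentRingsFieldProofs
import Literature.AlgebraicGeometry.Resolution.BlowupReducedDimension
import Literature.AlgebraicGeometry.Resolution.RegularLocalRingsQuotient
import Literature.AlgebraicGeometry.CossartJannsenSaito2020.KeyTheoremsAPI
import HarnessLib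

/-!
# [OURS · L1 W4.2] THE ISO-KERNEL SLICE IN COSSART–PILTANT'S FRAME — FINITE-TYPE FORM: the three bookkeeping hypotheses «singular /
# catenary / ψ ≤ N» of `false_of_isIsoPointTower_of_stalk_embeddings_of_CP` DISCHARGED for towers over a stage of finite type over a field

Crux chain w42 (`SigmaMaxModifications`, stmt-ResolutionOfSingularities-18506; conjunct `SigmaMaxModificationsCorridor3`, stmt-…-19249),
line `w_ladder`, registered stubs `stub_isoInsepTower` / `stub_isoSepRecurrent`. Lead res-L1-w42-lead-1 (gen 5). Helper file
`--supports stmt-ResolutionOfSingularities-19249`; kernel only (no definition, no new named fact; CONDITIONAL on the Literature named fact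
`CossartPiltant2019LocalPermissible` taken as a hypothesis, as its parent `…IsoKernelCPSlice`, p554446).

WHAT IS PROVED. Along a tower of blow-ups (`BlowupTower`) whose bottom stage is locally of finite type over a field: every stage is locally of
finite type over that field (`locallyOfFiniteType_phi_comp`), hence excellent (`Scheme.isExcellent_of_locallyOfFiniteType Stacks07QW_field_holds`)
with CATENARY stalks; the dimensions of the local rings at the marked points do not increase (`ringKrullDim_stalk_pt_le`,
`IsBlowup.ringKrullDim_stalk_le_of_isLocallyNoetherian`), so `ψ ≤ N` propagates from `dim 𝒪_{X_0,x_0} ≤ N`; and a marked point with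
`H_{X_n}(x_n) = ν ≠ Φ^{(N)}` is SINGULAR (`Scheme.mem_regularLocus_iff_hsFun_eq`). Hence (`false_of_isIsoPointTower_of_stalk_embeddings_of_CP_finiteType`)
the slice with hypotheses: CP's frame, an isolated E3 point tower with integral stages over a stage of finite type over a field, `ν ≠ Φ^{(N)}`,
`dim 𝒪_{X_0,x_0} ≤ N`, compatible injective stalk embeddings into `L`, and the origin germ = CP's germ ⇒ `False` (mod print).

HONEST FRAMING. OURS bookkeeping; nothing here is a statement of H. Hironaka's manuscript [Hironaka2017] nor a new claim about
[CossartPiltant2019] / [CossartJannsenSaito2020]. AI-written; AI review is weaker than expert review.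

References: V. Cossart, O. Piltant, J. Algebra 529 (2019), Thm. 1.5 [CossartPiltant2019]; V. Cossart, U. Jannsen, S. Saito, LNM 2270 (2020),
Lemma 2.31, Def. 6.38 [CossartJannsenSaito2020]; H. Matsumura, *Commutative ring theory*, Thm. 15.5 [Matsumura1987]; The Stacks Project, Tag 07QW
[StacksProject].
-/

noncomputable section

set_option linter.dupNamespace false

open Polynomial IsLocalRing AlgebraicGeometry CategoryTheory
open Literature.AlgebraicGeometry.Resolution Literature.AlgebraicGeometry.CossartJannsenSaito2020 Literature.RingTheory.HilbertSamuel
open Summit.ResolutionOfSingularities.ResolutionOfSingularities.Cruxes.SigmaMaxModifications.IdeasL1Idea2R4 (IsIsoPointTower)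

namespace Summit.ResolutionOfSingularities.ResolutionOfSingularities.Cruxes.SigmaMaxModifications.IdeasL1C5

universe u

/-! ## §1. Finite type, excellence and dimension along a tower of blow-ups -/

section TowerFT

variable (T : BlowupTower.{u})

/-- Every structure map `φ_n : X_n → X_0` of a tower of blow-ups is locally of finite type (blow-ups are proper). [folklore] -/
theorem locallyOfFiniteType_phi : ∀ n, LocallyOfFiniteType (T.phi n)
  | 0 => by
    change LocallyOfFiniteType (𝟙 (T.X 0))
    infer_instance
  | n + 1 => by
    haveI := locallyOfFiniteType_phi n
    haveI := T.ln n
    haveI := T.ln (n + 1)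
    haveI : IsProper (T.π n) := (T.isBlowup n).isProper
    rw [BlowupTower.phi_succ]
    infer_instance

/-- Every stage of a tower of blow-ups over a stage locally of finite type over a field is locally of finite type over that field. [folklore] -/
theorem locallyOfFiniteType_phi_comp {k : Type u} [Field k] (g : T.X 0 ⟶ Spec (.of k)) [LocallyOfFiniteType g] (n : ℕ) :
    LocallyOfFiniteType (T.phi n ≫ g) := by
  haveI := locallyOfFiniteType_phi T n
  infer_instance

/-- … hence excellent, so its local rings are catenary. [cite: StacksProject, Tag 07QW] -/
theorem isCatenaryRing_stalk_of_tower {k : Type u} [Field k] (g : T.X 0 ⟶ Spec (.of k)) [LocallyOfFiniteType g] (n : ℕ) (z : T.X n) :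
    IsCatenaryRing ((T.X n).presheaf.stalk z) := by
  haveI := T.ln n
  haveI := locallyOfFiniteType_phi_comp T g n
  exact Scheme.isCatenaryRing_stalk_of_isExcellent
    (Scheme.isExcellent_of_locallyOfFiniteType Stacks07QW_field_holds (T.phi n ≫ g)) z

variable {T} {pt : ∀ n, T.X n}

/-- **The local dimension at the marked points does not increase along the tower** (`dim 𝒪_{X_{n},x_{n}} ≤ dim 𝒪_{X_0,x_0}`; Matsumura 15.5
through `IsBlowup.ringKrullDim_stalk_le_of_isLocallyNoetherian`). [cite: Matsumura1987, Thm. 15.5] -/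
theorem ringKrullDim_stalk_pt_le (hpt : ∀ n, (T.π n).base (pt (n + 1)) = pt n) :
    ∀ n, ringKrullDim ((T.X n).presheaf.stalk (pt n)) ≤ ringKrullDim ((T.X 0).presheaf.stalk (pt 0))
  | 0 => le_rfl
  | n + 1 => by
    haveI := T.ln n
    have h := (T.isBlowup n).ringKrullDim_stalk_le_of_isLocallyNoetherian (pt (n + 1))
    rw [hpt n] at h
    exact h.trans (ringKrullDim_stalk_pt_le hpt n)

end TowerFT

/-! ## §2. The slice, finite-type form -/

section SliceFT

variable {L : Type u} [Field L]

/-- **THE ISO-KERNEL SLICE IN COSSART–PILTANT'S FRAME, FINITE-TYPE FORM (modulo print).** As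
`false_of_isIsoPointTower_of_stalk_embeddings_of_CP` (p554446), with «singular / catenary / `ψ ≤ N`» discharged: the bottom stage is locally of
finite type over a field `k`, the common Hilbert–Samuel value is `ν ≠ Φ^{(N)}` and `dim 𝒪_{X_0,x_0} ≤ N`. CONDITIONAL on
`CossartPiltant2019LocalPermissible`. [cite: CossartPiltant2019, Thm. 1.5 (arXiv v1: Thm. 1.4)] [cite: CossartJannsenSaito2020, Lemma 2.31, Def. 6.38]
[cite: Matsumura1987, Thm. 15.5] -/
theorem false_of_isIsoPointTower_of_stalk_embeddings_of_CP_finiteType (hCP : CossartPiltant2019LocalPermissible.{u})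
    (p : ℕ) (hp : p.Prime) (R : Subring L) [IsRegularLocalRing R]
    (hexc : IsExcellentRing R) (hdim : ringKrullDim R = 3) (hchar : CharP (ResidueField R) p)
    (h : R[X]) (x : L) (hmon : h.Monic) (hdeg : h.natDegree = p) (hx : aeval x h = 0)
    (hmin : ∀ g : R[X], g.natDegree < p → aeval x g = 0 → g = 0)
    (hgen : ∀ z : L, ∃ (g : R[X]) (s : R), s ≠ 0 ∧ z * s = aeval x g)
    (hcase : (CharP L p ∧ ∀ i, 0 < i → i < p → h.coeff i = 0) ∨
      (Nat.card (L ≃ₐ[R] L) = p ∧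
        ∀ σ : L ≃ₐ[R] L, ∀ y ∈ Algebra.adjoin R ({x} : Set L), σ y ∈ Algebra.adjoin R ({x} : Set L)))
    -- the isolated point tower over a stage of finite type over a field, read in `L`
    {N : ℕ} {ν : ℕ → ℕ} {T : BlowupTower.{u}} {pt : ∀ n, T.X n} (hT : IsIsoPointTower N ν T pt)
    (hint : ∀ n, IsIntegral (T.X n))
    {k : Type u} [Field k] (g : T.X 0 ⟶ Spec (.of k)) [LocallyOfFiniteType g]
    (hνΦ : ν ≠ iterPSum N Phi) (hd0 : ringKrullDim ((T.X 0).presheaf.stalk (pt 0)) ≤ N)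
    (θ : ∀ n, (T.X n).presheaf.stalk (pt n) →+* L) (hinj : ∀ n, Function.Injective (θ n))
    (hcomp : ∀ n, (θ (n + 1)).comp ((T.π n).stalkMap (pt (n + 1))).hom =
      (θ n).comp ((T.X n).presheaf.stalkCongr (.of_eq (hT.2.1 n))).hom.hom)
    -- the origin germ is Cossart–Piltant's germ
    (hR0 : R ≤ (θ 0).range) (hRdom : SubringDominates R (θ 0).range)
    (horigin : ∀ O : ValuationSubring L, SubringDominates (θ 0).range O.toSubring →
      (θ 0).range = locAtCentre (Algebra.adjoin R ({x} : Set L)).toSubring O) :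
    False := by
  -- dimension of the marked stalks: `dim 𝒪_{X_n,x_n} = d_n ≤ N`
  have hdn : ∀ n, ∃ d : ℕ, ringKrullDim ((T.X n).presheaf.stalk (pt n)) = d ∧ d ≤ N := by
    intro n
    haveI := T.ln n
    obtain ⟨d, hd⟩ := exists_nat_cast_eq_ringKrullDim (R := (T.X n).presheaf.stalk (pt n))
    refine ⟨d, hd, ?_⟩
    have hle := (ringKrullDim_stalk_pt_le hT.2.1 n).trans hd0
    rw [hd] at hle
    exact_mod_cast hle
  refine false_of_isIsoPointTower_of_stalk_embeddings_of_CP hCP p hp R hexc hdim hchar h x hmon hdeg hx hmin hgen hcase hT hint θ hinj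
    hcomp hR0 hRdom horigin (fun n => ?_) (fun n => isCatenaryRing_stalk_of_tower T g n (pt n)) (fun n => ?_)
  · -- singular: `H_{X_n}(x_n) = ν ≠ Φ^{(N)}` with `dim ≤ N`
    haveI := T.ln n
    obtain ⟨d, hd, hdN⟩ := hdn n
    intro hreg
    have hΦ : Scheme.hsFun (T.X n) N (pt n) = iterPSum N Phi :=
      (Scheme.mem_regularLocus_iff_hsFun_eq (pt n) hd hdN).mp hreg
    exact hνΦ ((hT.2.2.2.1 n).symm.trans hΦ)
  · -- `ψ ≤ dim ≤ N`
    haveI := T.ln n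
    obtain ⟨d, hd, hdN⟩ := hdn n
    exact (Scheme.hsPsi_le (pt n) hd).trans hdN

end SliceFT

end Summit.ResolutionOfSingularities.ResolutionOfSingularities.Cruxes.SigmaMaxModifications.IdeasL1C5

end
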